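import Mathlib.Analysis.Complex.UpperHalfPlane.MoebiusAction
import Literature.NumberTheory.EllipticCurves.ModularFormsGamma0Rank
import Mathlib.Analysis.Normed.Ring.Basic
import Mathlib.Analysis.Normed.Module.Basic
import Mathlib.Topology.MetricSpace.Isometry
import HarnessLib

/-!
# Joshi, *Construction of Arithmetic Teichmüller Spaces I* (arXiv:2106.11452v4) §2 «Classical Teichmüller Theory» —
# Thm. 2.1.1, Rmk. 2.1.2, §2.3 + Thm. 2.3.1, Rmk. 2.3.2, §2.4, Thm. 2.5.1, Rmks. 2.5.2/2.5.3, TYPED as data shells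

Record file of the abc-iut cell, branch E «type Joshi's construction, test vs S» (rung LADDER-ABC:A2.E; seat abc-iut-E-t24,
slot T-45 of the [J-I] fan-out; inventory `HOME/plan/E/t24/INVENTORY-T45.tsv`; companion `ATS1PerfectoidPreliminaries.lean`
for §3). Source: K. Joshi, arXiv 2106.11452 **v4** (bib `Joshi2021ATS1`, UNREFEREED, typed AS A CANDIDATE, D-0012); render
`HOME/plan/repair/lit/renders/Joshi-ATS1-2106.11452v4-PDFpaged-book-anonnd/` («p.N l.M» = line M of page file pNNNN.txt).
TYPED ≠ PROVED ≠ ENDORSED; no side taken on any author. §2 is the paper's EXPOSITORY recollection of classical Teichmüller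
theory ([Lehto 1987], [Nag 1988], [Imayoshi–Taniguchi 1992]) and of Nakai's Banach-algebra characterisation of
quasi-conformal / conformal equivalence ([Royden 1953], [Nakai 1959, 1960]) — «the one which my work imitates in the
arithmetic case» (p.5 l.20); it has NO bearing on `S` and none of it is in Mathlib (no Teichmüller space, quasi-conformal
maps, Royden algebras). Hence: the OBJECTS are INTERFACE SHELLS (structures whose fields quote print), the ASSERTED
sentences are `Prop`-valued definitions tagged `@[claim "Joshi2021ATS1" "disputed"]` (E-t1's registered status word for the
series; print's own textbook citations are carried in each docstring — the cited works have no bib keys in the tree), never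
asserted; what is PROVED is only what Mathlib decides about the printed genus-one instance (5): `T₁ = ℍ`, `Γ₁ = PSL₂(ℤ)`.

## What is printed and how it is typed

* **Thm. 2.1.1** (p.5 l.21 – p.6 l.11), items (1)–(8): `TeichmullerDatum` — (1) the points `T_g` (pairs `(Σ′, f)` up to
  Teichmüller equivalence), (3) the surjection `T_g → M_g`, (4) the group `Γ_g` acting on `T_g` with `T_g/Γ_g = M_g`, (8)
  `π_1(Σ′) ≃ π_1(Σ)` for every point, as FIELDS; (6) the fibre over `[Σ]` = `TeichmullerDatum.fiber` (definitional); (2)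
  (Riemannian metrics) and (7) (Virasoro uniformization, [Kontsevich 1987], [Beilinson–Schechtman 1988]; Rmk. 2.1.2: its
  arithmetic analogue is the paper's Thm. 5.21.1 = E-t1's `UntiltPoints.ptAct`) are quoted in docstrings only; (4)'s two
  adjectives «infinite» and «acts freely» are the claim-`Prop`s `InfiniteModularGroup`, `ActsFreely` AS PRINTED; (5) the
  genus-one case is the CONCRETE datum `genusOne` over Mathlib's `UpperHalfPlane` with `SL(2,ℤ)` acting through `PSL₂(ℤ)`.
  **Kernel notes on (4)∧(5) as printed** (faithfulness lane, no side taken): `infinite_SL2Z` («infinite» ✓ at `g = 1`;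
  at `g = 0` the mapping class group of the sphere is trivial — print says `g ≥ 0`); the tree's `ModularForms.S_smul_I` with `S_ne_one`, `S_ne_neg_one`:
  `S = (0 −1; 1 0)` fixes `i ∈ ℍ` and is not `±1`, so `PSL₂(ℤ)` does NOT act freely on `ℍ` (`genusOne_not_actsFreely`) — the
  textbook statement is «properly discontinuously» ([Imayoshi–Taniguchi 1992, §6]); recorded, not adjudicated.
* **§2.3 + Thm. 2.3.1** (p.6 l.30 – p.7 l.12; [Royden 1953], [Nakai 1959]): the Royden algebra `R_Σ` with `|f|_Σ = sup|f| +
  √D[f]` «is a commutative, complex Banach algebra» — the instance FIELDS of `RoydenDatum` (an interface whose axioms quote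
  print: `NormedCommRing`, `NormedAlgebra ℂ`, `CompleteSpace`); Rmk. 2.3.2 (1) «infinite dimensional» = claim-`Prop`
  `RoydenDatum.InfiniteDimensional`; (2) (other, weaker topologies) docstring only.
* **§2.4** (p.7 l.18–20) the Teichmüller category `𝒯_Σ`: `RoydenDatum.QCMaps.TeichObj` (pairs `(Σ′, f : Σ′ → Σ)`), morphisms =
  quasi-conformal maps `Σ′ → Σ″` (AS PRINTED: no compatibility with `f`, `g` is required).
* **Thm. 2.5.1** (p.7 l.24 – p.8 l.8; «my reformulation of main theorem of [Nakai, 1959, 1960]»; proof cites [Nakai 1960,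
  Thm. III.1, III.4, III.4(i), III.3(i)]): (1) `NakaiQuasiconformal`, (2) `NakaiHomeomorphism`, (3) `NakaiConformal`
  (claim/cite-`Prop`s over `RoydenDatum`), (4) functoriality = the DATA `RoydenDatum.QCMaps` (pull-back isomorphisms of
  Royden algebras along quasi-conformal maps, functorial), (5) the functor `𝒯_Σ → Banach algebras` = `teichFunctorObj/Map`
  (DEFINED from (4); contravariant on the printed morphisms — noted). Rmk. 2.5.2 (Banach–Colmez analogy) docstring only.
* **Rmk. 2.5.3** (p.8 l.14–27) «for each `(Σ′, f) ∈ 𝒯_Σ` one has a Banach algebra norm on the fixed ring `R = R_Σ` … a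
  distinguished collection `{(R, |−|_{Σ′}) : Σ′ ∈ 𝒯_Σ}` … classical Teichmüller Theory is a variation of Banach ring
  structures»: DEFINED — `pullbackNorm` (Mathlib `NormedCommRing.induced` along the iso `R_Σ ≃ R_Σ′`), `teichmullerNorms`.
Deliberately NOT here: any Riemann-surface analysis (Dirichlet integral, Tonelli absolute continuity), `M₁ = ℂ` via `j`
(not in Mathlib), the `p`-adic theory (§3ff: E-t1's `ArithTeichmullerSpace*`, this seat's `ATS1PerfectoidPreliminaries`).
[claim: Joshi2021ATS1, status: disputed]
-/

noncomputable section

namespace Summit.ABC.IUTFork.Joshi.ATS1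

universe u

/-! ## 1. Thm. 2.1.1: classical Teichmüller theory in a nutshell (data shell) -/

/-- **Thm. 2.1.1 as a data shell** (p.5 l.21 – p.6 l.11): «Let `Σ` be a connected, compact Riemann surface of topological
type `g ≥ 0` and let `T_g = T(Σ)` be the Teichmüller space of `Σ` and let `M_g` be the moduli of Riemann surfaces. Then (1)
`T_g` parameterizes, up to … Teichmüller equivalence, pairs `(Σ′, f)` consisting of a compact Riemann surface `Σ′` and a
non-constant quasi-conformal mapping `f : Σ′ → Σ` [Lehto 1987, Ch. V, 2.1] … `T_g` is not an algebraic variety or a scheme;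
(2) [pairs `(Σ, ds²)` up to equivalence, [Imayoshi–Taniguchi 1992, Thm. 1.8] — docstring only]; (3) … a natural, surjective
mapping `T_g → M_g` given by `(Σ′, f) ↦ [Σ′]`; (4) There exists an infinite discrete group, denoted `Γ_g` and called the
Teichmüller modular group or the mapping class group, which acts freely on `T_g` and `T_g → M_g` is the quotient mapping
`T_g → T_g/Γ_g = M_g` [Imayoshi–Taniguchi 1992, Ch. 6]; … (8) For every `(Σ′, f) ∈ T_g`, one has an isomorphism `π_1(Σ′) ≃
π(Σ)` … given by the homeomorphism underlying … `f`.» FIELDS = the data of (1), (3), (4) (action + quotient), (8); the two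
adjectives of (4) are `InfiniteModularGroup` / `ActsFreely` below. No Riemann surface is constructed: an INTERFACE.
[claim: Joshi2021ATS1, status: disputed] -/
structure TeichmullerDatum : Type (u + 1) where
  /-- (1) the points of `T_g = T(Σ)`: Teichmüller classes of pairs `(Σ′, f : Σ′ → Σ)` -/
  T : Type u
  /-- `M_g`, isomorphism classes `[Σ′]` of compact Riemann surfaces of genus `g` -/
  M : Type u
  /-- (3) `(Σ′, f) ↦ [Σ′]` -/
  cls : T → M
  /-- (3) «natural, surjective mapping» -/
  cls_surjective : Function.Surjective cls
  /-- (4) the Teichmüller modular group `Γ_g` -/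
  Γ : Type u
  [group : Group Γ]
  /-- (4) … acting on `T_g` -/
  [action : MulAction Γ T]
  /-- (4) «`T_g → M_g` is the quotient mapping `T_g → T_g/Γ_g = M_g`» -/
  cls_eq_iff : ∀ t t' : T, cls t = cls t' ↔ ∃ γ : Γ, γ • t' = t
  /-- (8) `π_1(Σ′)` for the point `(Σ′, f)` -/
  π : T → Type u
  [πGroup : ∀ t, Group (π t)]
  /-- `π_1(Σ)` -/
  π₀ : Type u
  [π₀Group : Group π₀]
  /-- (8) `π_1(Σ′) ≃ π_1(Σ)` induced by the homeomorphism underlying `f` -/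
  πIso : ∀ t, π t ≃* π₀

namespace TeichmullerDatum

attribute [instance] group action πGroup π₀Group

variable (D : TeichmullerDatum.{u})

/-- **Thm. 2.1.1 (6)** (p.6 l.3–4): «The fiber of the natural morphism `T_g → M_g` over the isomorphism class of `[Σ] ∈ M_g`
provides a collection of pairs `(Σ′, f) ∈ T_g` for which `[Σ′] = [Σ]`» — definitional. [claim: Joshi2021ATS1, status: disputed] -/
def fiber (m : D.M) : Set D.T := D.cls ⁻¹' {m}

/-- The fibre over `[Σ′]` consists of the points with `[Σ″] = [Σ′]`, i.e. the `Γ_g`-orbit (by (4)). [folklore] -/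
theorem mem_fiber_iff (t t' : D.T) : t' ∈ D.fiber (D.cls t) ↔ ∃ γ : D.Γ, γ • t = t' := by
  rw [fiber, Set.mem_preimage, Set.mem_singleton_iff]
  exact D.cls_eq_iff t' t

/-- **Thm. 2.1.1 (4), first adjective, AS PRINTED** (p.5 l.37): «There exists an infinite discrete group, denoted `Γ_g`».
Typed, NOT asserted (true for `g ≥ 1`, see `infinite_SL2Z`; for `g = 0` the mapping class group of the sphere is trivial —
print has `g ≥ 0`). [claim: Joshi2021ATS1, status: disputed] -/
@[claim "Joshi2021ATS1" "disputed"]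
def InfiniteModularGroup : Prop := Infinite D.Γ

/-- **Thm. 2.1.1 (4), second adjective, AS PRINTED** (p.5 l.38): «which acts freely on `T_g`». Typed, NOT asserted; see
`genusOne_not_actsFreely` for the printed genus-one case. [claim: Joshi2021ATS1, status: disputed] -/
@[claim "Joshi2021ATS1" "disputed"]
def ActsFreely : Prop := ∀ (γ : D.Γ) (t : D.T), γ • t = t → γ = 1

end TeichmullerDatum

/-! ## 2. Thm. 2.1.1 (5): the genus-one datum `T₁ = ℍ`, `Γ₁ = PSL₂(ℤ)` over Mathlib -/

open UpperHalfPlane in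
/-- **Thm. 2.1.1 (5) as a CONCRETE datum** (p.6 l.1–2): «For `g = 1` (elliptic curves), `T₁ = ℍ` is the upper half-plane,
`Γ₁ = PSL₂(ℤ)`, and `M₁ = ℍ/PSL₂(ℤ) = ℂ` [Imayoshi and Taniguchi, 1992, Chapter 1]»: `T := ℍ` (Mathlib `UpperHalfPlane`),
`Γ := SL(2,ℤ)` acting by Möbius transformations (Mathlib's action; it factors through `PSL₂(ℤ) = SL(2,ℤ)/{±1}`, same
orbits — READING of `Γ₁ = PSL₂(ℤ)`), `M := ℍ/SL(2,ℤ)` the orbit quotient (the identification `= ℂ` via `j` is not in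
Mathlib and not typed), `π_1 :=  ℤ × ℤ` at every point (the torus) with the identity isomorphisms. [claim: Joshi2021ATS1, status: disputed] -/
def genusOne : TeichmullerDatum.{0} where
  T := ℍ
  M := Quotient (MulAction.orbitRel (Matrix.SpecialLinearGroup (Fin 2) ℤ) ℍ)
  cls := Quotient.mk _
  cls_surjective := Quotient.mk_surjective
  Γ := Matrix.SpecialLinearGroup (Fin 2) ℤ
  cls_eq_iff t t' := by
    rw [Quotient.eq (r := MulAction.orbitRel _ ℍ)]
    exact MulAction.orbitRel_apply.trans MulAction.mem_orbit_iff
  π _ := Multiplicative (ℤ × ℤ)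
  π₀ := Multiplicative (ℤ × ℤ)
  πIso _ := MulEquiv.refl _

/-- `SL(2,ℤ)` is infinite: the translations `Tⁿ = (1 n; 0 1)` are pairwise distinct (so (4)'s «infinite» holds at `g = 1`;
`PSL₂(ℤ)`, a quotient by a group of order two, is then infinite as well). PROVED. [folklore] -/
theorem infinite_SL2Z : Infinite (Matrix.SpecialLinearGroup (Fin 2) ℤ) :=
  Infinite.of_injective (fun n : ℤ => ModularGroup.T ^ n) fun m n h => by
    have h' := congrArg (fun g : Matrix.SpecialLinearGroup (Fin 2) ℤ => (g : Matrix (Fin 2) (Fin 2) ℤ) 0 1) h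
    simpa [ModularGroup.coe_T_zpow] using h'

/-- (4)'s «infinite» for the genus-one datum. PROVED. [folklore] -/
theorem genusOne_infiniteModularGroup : genusOne.InfiniteModularGroup := infinite_SL2Z

/-- **Kernel note on (4)∧(5) as printed**: `S = (0 −1; 1 0) ∈ SL(2,ℤ)` FIXES `i ∈ ℍ` (`S·i = −1/i = i`) — already in the
tree as `Literature.NumberTheory.EllipticCurves.ModularForms.S_smul_I`, reused — and `S ≠ 1`. PROVED. [folklore] -/
theorem S_ne_one : ModularGroup.S ≠ 1 := by
  intro h
  have h' := congrArg (fun g : Matrix.SpecialLinearGroup (Fin 2) ℤ => (g : Matrix (Fin 2) (Fin 2) ℤ) 1 0) h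
  simp [ModularGroup.S] at h'

/-- … and `S ≠ −1`, so the image of `S` in `PSL₂(ℤ) = SL(2,ℤ)/{±1}` is a NON-TRIVIAL element fixing `i`: the action of
`Γ₁ = PSL₂(ℤ)` on `T₁ = ℍ` is not free (stabilisers of `i` and `e^{2πi/3}` have orders 2 and 3 in `PSL₂(ℤ)`); the standard
statement behind (4) is «acts properly discontinuously» [Imayoshi–Taniguchi 1992, §6]. Recorded for the faithfulness lane;
expository item, no bearing on §3ff. PROVED. [folklore] -/
theorem S_ne_neg_one : ModularGroup.S ≠ -1 := by
  intro h
  have h' := congrArg (fun g : Matrix.SpecialLinearGroup (Fin 2) ℤ => (g : Matrix (Fin 2) (Fin 2) ℤ) 1 0) h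
  simp [ModularGroup.S] at h'

/-- Hence the genus-one datum (with `SL(2,ℤ)`, a fortiori with `PSL₂(ℤ)`, see `S_ne_neg_one`) does not satisfy `ActsFreely`
as printed. PROVED. [folklore] -/
theorem genusOne_not_actsFreely : ¬ genusOne.ActsFreely := fun h =>
  S_ne_one (h ModularGroup.S UpperHalfPlane.I Literature.NumberTheory.EllipticCurves.ModularForms.S_smul_I)

/-! ## 3. §2.3, Thm. 2.3.1, §2.4: Royden algebras (interface shell) and the Teichmüller category -/

/-- **The Royden algebras with Nakai's equivalence relations, as an interface** (§2.3 p.6 l.30 – p.7 l.6: «the Royden algebra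
`R_Σ` of a connected Riemann surface `Σ` is the `ℂ`-algebra of all complex valued functions `f : Σ → ℂ` satisfying … (1) `f`
is absolutely continuous on `Σ` in the Tonelli sense, (2) `|f|` is bounded on `Σ`, and (3) the Dirichlet integral `D[f] < ∞`
… `|f|_Σ = sup_Σ |f| + √D[f]`»; **Thm. 2.3.1** p.7 l.7–12, «proved in [Royden, 1953] [Nakai, 1959]»: «(1) The mapping `|−|_Σ
: R_Σ → ℝ` … defines a norm on `R_Σ`, and (2) the normed algebra `(R_Σ, |−|_Σ)` is a commutative, complex Banach algebra»):
for each connected Riemann surface `Σ` (an abstract index here) the commutative complex Banach algebra `R_Σ` — Thm. 2.3.1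
(1)(2) ARE the instance fields (interface whose axioms quote print) — together with the two relations Thm. 2.5.1 speaks
about: «`Σ, Σ′` are quasi-conformal» (a quasi-conformal homeomorphism exists) and «conformally equivalent (i.e. the Riemann
surfaces are isomorphic)». Rmk. 2.3.2 (2) (p.7 l.16–17: «`R_Σ` is also equipped with several different topologies other than
its norm-topology. The norm topology is the strongest among these» [Nakai 1960]) is quoted only. No Riemann surface, no
Dirichlet integral is constructed. [claim: Joshi2021ATS1, status: disputed] -/
structure RoydenDatum : Type (u + 1) where
  /-- connected Riemann surfaces `Σ` (abstract) -/
  RS : Type u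
  /-- «`Σ, Σ′` are quasi-conformal» -/
  QC : RS → RS → Prop
  /-- «`Σ` and `Σ′` are conformally equivalent (i.e. the Riemann surfaces are isomorphic)» -/
  Conf : RS → RS → Prop
  /-- the Royden algebra `R_Σ` … -/
  R : RS → Type u
  /-- … with `|−|_Σ`, a commutative Banach algebra (Thm. 2.3.1 (1),(2)) … -/
  [normedCommRing : ∀ S, NormedCommRing (R S)]
  /-- … over `ℂ` … -/
  [normedAlgebra : ∀ S, NormedAlgebra ℂ (R S)]
  /-- … complete -/
  [completeSpace : ∀ S, CompleteSpace (R S)]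

namespace RoydenDatum

attribute [instance] normedCommRing normedAlgebra completeSpace

variable (D : RoydenDatum.{u})

/-- **Rmk. 2.3.2 (1)** (p.7 l.14–15): «`R_Σ` is an infinite dimensional, commutative Banach algebra even if `Σ` is a compact
Riemann surface.» Typed, NOT asserted. [claim: Joshi2021ATS1, status: disputed] -/
@[claim "Joshi2021ATS1" "disputed"]
def InfiniteDimensional : Prop := ∀ S : D.RS, ¬ FiniteDimensional ℂ (D.R S)

/-- **Thm. 2.5.1 (1)** (p.7 l.25–27; proof: [Nakai 1960, Thm. III.1]): «`Σ, Σ′` are quasi-conformal if and only if one has a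
`ℂ`-algebra isomorphism `R_Σ ≃ R_Σ′` between their Royden algebras.» Typed, NOT asserted. [claim: Joshi2021ATS1, status: disputed] -/
@[claim "Joshi2021ATS1" "disputed"]
def NakaiQuasiconformal : Prop := ∀ S S' : D.RS, D.QC S S' ↔ Nonempty (D.R S ≃ₐ[ℂ] D.R S')

/-- **Thm. 2.5.1 (2)** (p.7 l.28–29; [Nakai 1960, Thm. III.4]): «Any `ℂ`-algebra isomorphism `R_Σ ≃ R_Σ′` is a homeomorphism
for the respective norm-topologies.» Typed, NOT asserted. [claim: Joshi2021ATS1, status: disputed] -/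
@[claim "Joshi2021ATS1" "disputed"]
def NakaiHomeomorphism : Prop := ∀ (S S' : D.RS) (e : D.R S ≃ₐ[ℂ] D.R S'), Continuous e ∧ Continuous e.symm

/-- **Thm. 2.5.1 (3)** (p.7 l.30–33; [Nakai 1960, Thm. III.4 (i)]): «`Σ` and `Σ′` are conformally equivalent (i.e. the Riemann
surfaces are isomorphic) if and only if `(R_Σ, |−|_Σ) ≃ (R_Σ′, |−|_Σ′)` is an isometry of Banach algebras» — read: iff SOME
`ℂ`-algebra isomorphism is an isometry. Typed, NOT asserted. [claim: Joshi2021ATS1, status: disputed] -/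
@[claim "Joshi2021ATS1" "disputed"]
def NakaiConformal : Prop := ∀ S S' : D.RS, D.Conf S S' ↔ ∃ e : D.R S ≃ₐ[ℂ] D.R S', Isometry e

/-- **Thm. 2.5.1 (4) as DATA** (p.7 l.34–35; [Nakai 1960, Thm. III.3 (i)]): «The construction of `(R_Σ, |−|_Σ)` is functorial
for quasi-conformal mappings between Riemann surfaces» — quasi-conformal maps `h : Σ → Σ′` (abstract, with identities and
composition), each inducing by pull-back `f ↦ f ∘ h` a `ℂ`-algebra isomorphism `R_Σ′ ≃ R_Σ` (an ISOMORPHISM because the maps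
in play are homeomorphisms, Thm. 2.1.1 (1); Rmk. 2.5.3 «the isomorphism `R_Σ′ → R_Σ` induced by `f`»), functorially; and a
quasi-conformal map witnesses the relation `QC`. [claim: Joshi2021ATS1, status: disputed] -/
structure QCMaps : Type (u + 1) where
  /-- quasi-conformal mappings `Σ → Σ′` -/
  Map : D.RS → D.RS → Type u
  /-- the identity -/
  id : ∀ S, Map S S
  /-- composition `h′ ∘ h` -/
  comp : ∀ {S S' S''}, Map S S' → Map S' S'' → Map S S''
  /-- pull-back `R_Σ′ ≃ R_Σ` along `h : Σ → Σ′` -/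
  pull : ∀ {S S'}, Map S S' → (D.R S' ≃ₐ[ℂ] D.R S)
  /-- functoriality: identities -/
  pull_id : ∀ S, pull (id S) = AlgEquiv.refl
  /-- functoriality: composites (contravariant) -/
  pull_comp : ∀ {S S' S''} (h : Map S S') (h' : Map S' S''), pull (comp h h') = (pull h').trans (pull h)
  /-- a quasi-conformal map makes `Σ, Σ′` quasi-conformal -/
  qc_of_map : ∀ {S S'}, Map S S' → D.QC S S'

namespace QCMaps

variable {D} (Q : D.QCMaps)

/-- **§2.4, objects of the Teichmüller category `𝒯_Σ`** (p.7 l.18–19: «objects are the points of `T_Σ` i.e. … Riemann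
surfaces `(Σ′, f : Σ′ → Σ) ∈ T_Σ`»): a surface `Σ′` with a quasi-conformal map to `Σ`. [claim: Joshi2021ATS1, status: disputed] -/
structure TeichObj (S : D.RS) : Type u where
  /-- `Σ′` -/
  src : D.RS
  /-- `f : Σ′ → Σ` -/
  map : Q.Map src S

/-- **§2.4, morphisms of `𝒯_Σ`** (p.7 l.19–20: «A morphism between `(Σ′, f : Σ′ → Σ) → (Σ″, g : Σ″ → Σ)` is a quasi-conformal
mapping `h : Σ′ → Σ″`») — AS PRINTED no compatibility of `h` with `f`, `g` is required. [claim: Joshi2021ATS1, status: disputed] -/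
def TeichHom {S : D.RS} (A B : Q.TeichObj S) : Type u := Q.Map A.src B.src

/-- `(Σ, id)` is an object of `𝒯_Σ` (the base point of `T_Σ`). [folklore] -/
def TeichObj.base (S : D.RS) : Q.TeichObj S := ⟨S, Q.id S⟩

/-- **Thm. 2.5.1 (5) on objects** (p.8 l.1–4: «one has a functor `(Σ′, f : Σ′ → Σ) ↦ (R_Σ′, |−|_Σ′)` from the Teichmüller
category `𝒯_Σ` to the category of infinite dimensional complex Banach algebras»): DEFINED. [claim: Joshi2021ATS1, status: disputed] -/
def teichFunctorObj {S : D.RS} (A : Q.TeichObj S) : Type u := D.R A.src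

/-- **Thm. 2.5.1 (5) on morphisms**: `h : Σ′ → Σ″` goes to the pull-back `R_Σ″ ≃ R_Σ′` of (4) — CONTRAVARIANT on the
printed morphisms (print: «should be clear from the previous four assertions»). DEFINED. [claim: Joshi2021ATS1, status: disputed] -/
def teichFunctorMap {S : D.RS} {A B : Q.TeichObj S} (h : Q.TeichHom A B) : D.R B.src ≃ₐ[ℂ] D.R A.src := Q.pull h

/-- Functoriality of (5), from (4): composites go to composites (contravariantly). PROVED from the data. [folklore] -/
theorem teichFunctorMap_comp {S : D.RS} {A B C : Q.TeichObj S} (h : Q.TeichHom A B) (h' : Q.TeichHom B C) :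
    Q.teichFunctorMap (Q.comp h h' : Q.TeichHom A C) = (Q.teichFunctorMap h').trans (Q.teichFunctorMap h) :=
  Q.pull_comp h h'

/-- (1) applied to an object of `𝒯_Σ`: every `R_Σ′` is `ℂ`-algebra-isomorphic to `R_Σ` (the pull-back along `f`), so under
`NakaiQuasiconformal` all surfaces in `𝒯_Σ` are quasi-conformal to `Σ` — Rmk. 2.5.2 (1) «quasi-conformality … has a purely
algebraic characterization». PROVED from the data. [folklore] -/
theorem TeichObj.qc {S : D.RS} (A : Q.TeichObj S) : D.QC A.src S := Q.qc_of_map A.map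

/-! ## 4. Rmk. 2.5.3: Teichmüller theory as a variation of Banach-algebra norms on the fixed ring `R = R_Σ` -/

/-- **Rmk. 2.5.3, the pulled-back norm** (p.8 l.14–18: «Let `f : Σ′ → Σ` be a quasi-conformal mapping. Then using the
isomorphism `R_Σ′ → R_Σ` induced by `f` one can pull-back the norm `|−|_Σ′` of `R_Σ′` and write `(R_Σ, |−|_Σ′)` for the norm
on `R_Σ` given using `(Σ′, f)`. Thus for each `(Σ′, f) ∈ T_Σ`, one has a Banach algebra norm on the fixed topological ring
`R = R_Σ`»): the normed-commutative-ring structure on `R_Σ` induced (Mathlib `NormedCommRing.induced`) along the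
pull-back isomorphism `R_Σ ≃ R_Σ′`, `x ↦ x ∘ f`. DEFINED. [claim: Joshi2021ATS1, status: disputed] -/
abbrev pullbackNorm {S : D.RS} (A : Q.TeichObj S) : NormedCommRing (D.R S) :=
  NormedCommRing.induced (D.R S) (D.R A.src) (Q.pull A.map : D.R S →ₐ[ℂ] D.R A.src) (Q.pull A.map).injective

/-- The pulled-back norm of `x ∈ R_Σ` is `|x ∘ f|_Σ′` (the pull-back isomorphism `R_Σ ≃ R_Σ′` applied to `x`). [folklore] -/
theorem pullbackNorm_norm {S : D.RS} (A : Q.TeichObj S) (x : D.R S) :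
    @norm _ (Q.pullbackNorm A).toNorm x = ‖Q.pull A.map x‖ := rfl

/-- **Rmk. 2.5.3, the distinguished collection** (p.8 l.18–23: «classical Teichmüller theory provides a distinguished
collection `{(R, |−|_Σ′) : Σ′ ∈ T_Σ}` of Banach algebra norms on the fixed topological ring `R`. Thus one may view classical
Teichmüller Theory as … a variation of Banach ring structures»): the set of norm functions on `R_Σ` arising from the objects
of `𝒯_Σ`. DEFINED. [claim: Joshi2021ATS1, status: disputed] -/
def teichmullerNorms (S : D.RS) : Set (D.R S → ℝ) :=
  Set.range fun A : Q.TeichObj S => fun x => ‖Q.pull A.map x‖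

/-- The original norm `|−|_Σ` belongs to the collection (from the base object `(Σ, id)`). PROVED. [folklore] -/
theorem norm_mem_teichmullerNorms (S : D.RS) : (fun x : D.R S => ‖x‖) ∈ Q.teichmullerNorms S := by
  refine ⟨TeichObj.base Q S, funext fun x => ?_⟩
  show ‖Q.pull (Q.id S) x‖ = ‖x‖
  simp only [Q.pull_id S, AlgEquiv.coe_refl, id_eq]

end QCMaps

end RoydenDatum

/-! ## 5. Thm. 2.1.1 (5) with `Γ₁ = PSL₂(ℤ)` LITERALLY (follow-up to the review of p432939; landed docstrings unedited)
(n4) `genusOne` has `Γ := SL(2,ℤ)` acting through `PSL₂(ℤ)`, so `genusOne_not_actsFreely` is formally about `SL(2,ℤ)` (where `−1`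
alone breaks freeness); here `Γ₁ := PSL₂(ℤ) = SL(2,ℤ)/centre` acts on `ℍ` itself and (4)'s «acts freely» AS PRINTED is refuted
for it (`genusOnePSL_not_actsFreely`: the class of `S` is non-trivial and fixes `i`). (n5) Thm. 2.1.1 (4) has THREE adjectives —
«infinite» (`InfiniteModularGroup`, PROVED for both data), «discrete» (NOT typed: no topology on `Γ` in the shell), «acts freely»
(`ActsFreely`, refuted as printed; textbooks: «properly discontinuously»). Expository; no bearing on §3ff; no side taken. -/

open UpperHalfPlane

/-- `SL(2,ℤ)` (Mathlib `Matrix.SpecialLinearGroup (Fin 2) ℤ`). [folklore] -/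
abbrev SL2Z : Type := Matrix.SpecialLinearGroup (Fin 2) ℤ
/-- **`PSL₂(ℤ) = SL(2,ℤ)/{±1}`**, the quotient by the centre (`= {±1}`, Mathlib `SpecialLinearGroup.mem_center_iff`). [folklore] -/
abbrev PSL2Z : Type := SL2Z ⧸ Subgroup.center SL2Z

/-- Central elements of `SL(2,ℤ)` (`= ±1`) act trivially on `ℍ` (Mathlib `ModularGroup.SL_neg_smul`). [folklore] -/
theorem smul_eq_self_of_mem_center (g : SL2Z) (hg : g ∈ Subgroup.center SL2Z) (z : ℍ) : g • z = z := by
  obtain ⟨r, hr2, hr⟩ := Matrix.SpecialLinearGroup.mem_center_iff.mp hg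
  have hr2' : r ^ 2 = 1 := by simpa using hr2
  rcases sq_eq_one_iff.mp hr2' with h1 | h1
  · rw [show g = 1 from Subtype.ext (by rw [← hr, h1]; simp), one_smul]
  · rw [show g = -1 from Subtype.ext (by rw [← hr, h1]; simp), ModularGroup.SL_neg_smul, one_smul]

/-- The Möbius action descended to `PSL₂(ℤ)`: `SL(2,ℤ) → Perm ℍ` factored through the quotient by the centre. [folklore] -/
def pslToPerm : PSL2Z →* Equiv.Perm ℍ :=
  QuotientGroup.lift (Subgroup.center SL2Z) (MulAction.toPermHom SL2Z ℍ) fun g hg =>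
    Equiv.ext fun z => by simpa using smul_eq_self_of_mem_center g hg z

/-- `S = (0 −1; 1 0)` is NOT central (central = scalar): its class in `PSL₂(ℤ)` is non-trivial. PROVED. [folklore] -/
theorem S_not_mem_center : ModularGroup.S ∉ Subgroup.center SL2Z := fun h => by
  obtain ⟨r, -, hr⟩ := Matrix.SpecialLinearGroup.mem_center_iff.mp h
  have h10 := congrArg (fun A : Matrix (Fin 2) (Fin 2) ℤ => A 1 0) hr
  rw [Matrix.scalar_apply, Matrix.diagonal_apply_ne _ (by decide)] at h10
  simp [ModularGroup.S] at h10

/-- **Thm. 2.1.1 (5) with `Γ₁ = PSL₂(ℤ)` literally** (p.6 l.1–2: «For `g = 1` (elliptic curves), `T₁ = ℍ` is the upper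
half-plane, `Γ₁ = PSL₂(ℤ)`, and `M₁ = ℍ/PSL₂(ℤ) = ℂ`»): as `genusOne`, but `Γ := PSL2Z = SL(2,ℤ)/centre` acting on `ℍ` by the
descended Möbius action (`pslToPerm`; the `MulAction` is the structure field — no global instance), `M := ℍ/SL(2,ℤ)` (same
orbits); «`= ℂ`» (via `j`) not typed; no topology on `Γ` («discrete» not typed, (n5)). [claim: Joshi2021ATS1, status: disputed] -/
def genusOnePSL : TeichmullerDatum.{0} where
  T := ℍ
  M := Quotient (MulAction.orbitRel SL2Z ℍ)
  cls := Quotient.mk _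
  cls_surjective := Quotient.mk_surjective
  Γ := PSL2Z
  action := MulAction.compHom ℍ pslToPerm
  cls_eq_iff t t' := by
    rw [Quotient.eq (r := MulAction.orbitRel _ ℍ), MulAction.orbitRel_apply, MulAction.mem_orbit_iff]
    refine ⟨fun ⟨g, hg⟩ => ⟨(g : PSL2Z), hg⟩, fun ⟨γ, hγ⟩ => ?_⟩
    induction γ using QuotientGroup.induction_on with
    | H g => exact ⟨g, hγ⟩
  π _ := Multiplicative (ℤ × ℤ)
  π₀ := Multiplicative (ℤ × ℤ)
  πIso _ := MulEquiv.refl _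

/-- (4)'s «infinite» for `Γ₁ = PSL₂(ℤ)`: the classes of the `Tⁿ` are pairwise distinct (a central `T^{n−m}` is scalar). [folklore] -/
theorem genusOnePSL_infiniteModularGroup : genusOnePSL.InfiniteModularGroup :=
  Infinite.of_injective (fun n : ℤ => ((ModularGroup.T ^ n : SL2Z) : PSL2Z)) fun m n h => by
    have hmem : (ModularGroup.T ^ m)⁻¹ * ModularGroup.T ^ n ∈ Subgroup.center SL2Z := QuotientGroup.eq.mp h
    rw [← zpow_neg, ← zpow_add] at hmem
    obtain ⟨r, -, hr⟩ := Matrix.SpecialLinearGroup.mem_center_iff.mp hmem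
    have h01 := congrArg (fun A : Matrix (Fin 2) (Fin 2) ℤ => A 0 1) hr
    rw [Matrix.scalar_apply, Matrix.diagonal_apply_ne _ (by decide), ModularGroup.coe_T_zpow] at h01
    simp only [Matrix.of_apply, Matrix.cons_val', Matrix.cons_val_zero, Matrix.cons_val_one] at h01; omega

/-- **(4)∧(5) AS PRINTED, refuted formally for `Γ₁ = PSL₂(ℤ)`**: the class of `S` in `PSL₂(ℤ)` is `≠ 1` (`S_not_mem_center`)
and fixes `i ∈ ℍ` (the tree's `ModularForms.S_smul_I`), so `PSL₂(ℤ)` does not act freely on `T₁ = ℍ` (standard statement: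
properly discontinuously, finite stabilisers). Expository; recorded for the faithfulness lane. PROVED. [folklore] -/
theorem genusOnePSL_not_actsFreely : ¬ genusOnePSL.ActsFreely := fun h => by
  refine S_not_mem_center ((QuotientGroup.eq_one_iff _).mp (h _ (show genusOnePSL.T from I) ?_))
  exact (show pslToPerm ((ModularGroup.S : SL2Z) : PSL2Z) I = I from Literature.NumberTheory.EllipticCurves.ModularForms.S_smul_I)

end Summit.ABC.IUTFork.Joshi.ATS1

end
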